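import Summits.CriticalPhenomena.SAWScalingLimit.Theorems.SAWDefectDecoherenceBoundaryClosureRInnerPolygonsBoundaryWalk
import HarnessLib

/-!
# Crux `BoundaryClosureR` (stmt-CriticalPhenomena-14004), line `polygon-parity-squeeze`,
# stub `stub_innerPolygons` (IP): the fan of `K`-faces at a vertex of the boundary walk

Landing target:
`Summits/CriticalPhenomena/SAWScalingLimit/Theorems/SAWDefectDecoherenceBoundaryClosureRInnerPolygonsFan.lean`
(`--supports stmt-CriticalPhenomena-14004`; building block of the registered stub `stub_innerPolygons`,
input of FACT 3b: the corner type of the inner polygon at a vertex of its boundary cycle).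

At the head `y` of a boundary dart `(x, k)` of a pinch-free triangle set `K` the left-hand successor
`bsucc K (x, k) = (y, j)` turns by `j - k ∈ {+2, +1, 0, -1, -2}` (sharp left, left, straight, right,
sharp right).  Under NO PINCH the whole configuration of the six faces round `y` is then determined:
the `K`-faces at `y` are EXACTLY `faceL y j, faceL y (j+1), …, faceL y (k+2)` — a contiguous fan of
`1, 2, 3, 4, 5` faces (interior angle `60°, 120°, 180°, 240°, 300°` of the cell union at `y`), all
other faces round `y` being off `K` (`fan_at_head`).  With `…InnerPolygonsLocalCells.lean` (cells near
a vertex are wedges) this identifies the cell union near every vertex of the boundary cycle with a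
zigzag wedge: one/two closed half-planes intersected (`1, 2` faces), a closed half-plane (`3`), the
union of two (`4, 5`).

* `switch_pattern` — the `decide`d core: a `6`-cycle of Booleans with at most one `true → false`
  switch, `true` at `2` and `false` at `3`, follows a staircase pattern (pointwise form);
* `fan_at_head` — the statement above as an explicit five-way case split, by rotation to `k = 0`.

Sources: folklore.  No proposition is defined and no named fact is introduced.
-/

noncomputable section

open scoped Classical
open Literature.Probability.LatticeModels
open Literature.Probability.Percolation (triDir)

namespace Summit.CriticalPhenomena.SAWScalingLimit.Theorems.PolygonParitySqueeze.BoundaryWalk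

/-- **The staircase patterns, pointwise.** A `6`-cycle of Booleans with at most one anticlockwise
`true → false` switch which is `true` at `2` and `false` at `3` is `true` exactly on a contiguous
block ending at `2`: the first `false` among the positions `1, 0, 5, 4` switches everything after it
off. [folklore] -/
theorem switch_pattern (f : Fin 6 → Bool)
    (h : (Finset.univ.filter fun k : Fin 6 => f k = true ∧ f (k + 1) = false).card ≤ 1)
    (h2 : f 2 = true) (h3 : f 3 = false) :
    (f 1 = false → f 0 = false ∧ f 5 = false ∧ f 4 = false) ∧
    (f 0 = false → f 5 = false ∧ f 4 = false) ∧
    (f 5 = false → f 4 = false) := by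
  revert f
  decide

variable {K : Finset HexVertex}

/-- **The fan of `K`-faces at the head of a boundary dart** (no pinch).  Let `(x, k)` be a boundary
dart of `K`, `y = x + triDir k` its head.  Then `faceL y (k+2) ∈ K`, `faceL y (k+3) ∉ K`, and the
other four faces round `y` follow one of the five staircase patterns, matching the turn of the
successor: with `j = (bsucc K (x, k)).2`,
`j = k+2`: `k+1, k, k+5, k+4 ∉ K` (fan of `1`, `60°`); `j = k+1`: `k+1 ∈ K`, `k, k+5, k+4 ∉ K`
(`120°`); `j = k`: `k+1, k ∈ K`, `k+5, k+4 ∉ K` (`180°`, flat); `j = k+5`: `k+1, k, k+5 ∈ K`,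
`k+4 ∉ K` (`240°`); `j = k+4`: `k+1, k, k+5, k+4 ∈ K` (`300°`). [folklore] -/
theorem fan_at_head (hK : ∀ y : Site 2, (Finset.univ.filter fun k : Fin 6 => faceL y k ∈ K ∧ faceL y (k + 1) ∉ K).card ≤ 1)
    {x : Site 2} {k : Fin 6} (hp : (x, k) ∈ bdDarts K) :
    faceL (x + triDir k) (k + 2) ∈ K ∧ faceL (x + triDir k) (k + 3) ∉ K ∧
    (((bsucc K (x, k)).2 = k + 2 ∧ faceL (x + triDir k) (k + 1) ∉ K ∧ faceL (x + triDir k) k ∉ K ∧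
        faceL (x + triDir k) (k + 5) ∉ K ∧ faceL (x + triDir k) (k + 4) ∉ K) ∨
      ((bsucc K (x, k)).2 = k + 1 ∧ faceL (x + triDir k) (k + 1) ∈ K ∧ faceL (x + triDir k) k ∉ K ∧
        faceL (x + triDir k) (k + 5) ∉ K ∧ faceL (x + triDir k) (k + 4) ∉ K) ∨
      ((bsucc K (x, k)).2 = k ∧ faceL (x + triDir k) (k + 1) ∈ K ∧ faceL (x + triDir k) k ∈ K ∧
        faceL (x + triDir k) (k + 5) ∉ K ∧ faceL (x + triDir k) (k + 4) ∉ K) ∨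
      ((bsucc K (x, k)).2 = k + 5 ∧ faceL (x + triDir k) (k + 1) ∈ K ∧ faceL (x + triDir k) k ∈ K ∧
        faceL (x + triDir k) (k + 5) ∈ K ∧ faceL (x + triDir k) (k + 4) ∉ K) ∨
      ((bsucc K (x, k)).2 = k + 4 ∧ faceL (x + triDir k) (k + 1) ∈ K ∧ faceL (x + triDir k) k ∈ K ∧
        faceL (x + triDir k) (k + 5) ∈ K ∧ faceL (x + triDir k) (k + 4) ∈ K)) := by
  set y := x + triDir k with hy
  obtain ⟨hL, hR⟩ := mem_bdDarts.1 hp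
  obtain ⟨h2, h3⟩ := faceL_head x k
  simp only at hL hR
  have hK2 : faceL y (k + 2) ∈ K := by rw [h2]; exact hL
  have hK3 : faceL y (k + 3) ∉ K := by rw [h3]; exact hR
  -- the rotated Boolean pattern `f i = [faceL y (k + i) ∈ K]`
  set f : Fin 6 → Bool := fun i => decide (faceL y (k + i) ∈ K) with hf
  have hsw : (Finset.univ.filter fun i : Fin 6 => f i = true ∧ f (i + 1) = false).card ≤ 1 := by
    have hKy := hK y
    have : (Finset.univ.filter fun i : Fin 6 => f i = true ∧ f (i + 1) = false) =
        (Finset.univ.filter fun k' : Fin 6 => faceL y k' ∈ K ∧ faceL y (k' + 1) ∉ K).image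
          fun k' => k' - k := by
      ext i
      simp only [hf, Finset.mem_filter, Finset.mem_univ, true_and, Finset.mem_image, decide_eq_true_eq,
        decide_eq_false_iff_not]
      constructor
      · rintro ⟨ha, hb⟩
        exact ⟨k + i, ⟨ha, by rw [add_assoc]; exact hb⟩, by abel⟩
      · rintro ⟨k', ⟨ha, hb⟩, rfl⟩
        refine ⟨by rw [add_sub_cancel]; exact ha, ?_⟩
        rw [← add_assoc, add_sub_cancel]; exact hb
    rw [this]
    exact Finset.card_image_le.trans hKy
  have hf2 : f 2 = true := by simp only [hf, decide_eq_true_eq]; exact hK2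
  have hf3 : f 3 = false := by simp only [hf, decide_eq_false_iff_not]; exact hK3
  obtain ⟨c1, c0, c5⟩ := switch_pattern f hsw hf2 hf3
  have mem1 : faceL y (k + 1) ∉ K ↔ f 1 = false := by simp [hf]
  have mem0 : faceL y k ∉ K ↔ f 0 = false := by simp [hf]
  have mem5 : faceL y (k + 5) ∉ K ↔ f 5 = false := by simp [hf]
  have mem4 : faceL y (k + 4) ∉ K ↔ f 4 = false := by simp [hf]
  refine ⟨hK2, hK3, ?_⟩
  unfold bsucc
  simp only
  rw [← hy]
  split_ifs with b1 b0 b5 b4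
  · exact Or.inr (Or.inr (Or.inr (Or.inr ⟨rfl, b1, b0, b5, b4⟩)))
  · exact Or.inr (Or.inr (Or.inr (Or.inl ⟨rfl, b1, b0, b5, b4⟩)))
  · exact Or.inr (Or.inr (Or.inl ⟨rfl, b1, b0, b5, mem4.2 (c5 (mem5.1 b5))⟩))
  · obtain ⟨d5, d4⟩ := c0 (mem0.1 b0)
    exact Or.inr (Or.inl ⟨rfl, b1, b0, mem5.2 d5, mem4.2 d4⟩)
  · obtain ⟨d0, d5, d4⟩ := c1 (mem1.1 b1)
    exact Or.inl ⟨rfl, b1, mem0.2 d0, mem5.2 d5, mem4.2 d4⟩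

/-- **The fan at the head of a boundary dart** (registered form, sub-goal of `stub_innerPolygons`).
[folklore] -/
theorem boundaryWalk_fan : ∀ (K : Finset HexVertex), (∀ y : Site 2, (Finset.univ.filter fun k : Fin 6 => faceL y k ∈ K ∧ faceL y (k + 1) ∉ K).card ≤ 1) → ∀ (x : Site 2) (k : Fin 6), (x, k) ∈ bdDarts K → faceL (x + triDir k) (k + 2) ∈ K ∧ faceL (x + triDir k) (k + 3) ∉ K ∧ (((bsucc K (x, k)).2 = k + 2 ∧ faceL (x + triDir k) (k + 1) ∉ K ∧ faceL (x + triDir k) k ∉ K ∧ faceL (x + triDir k) (k + 5) ∉ K ∧ faceL (x + triDir k) (k + 4) ∉ K) ∨ ((bsucc K (x, k)).2 = k + 1 ∧ faceL (x + triDir k) (k + 1) ∈ K ∧ faceL (x + triDir k) k ∉ K ∧ faceL (x + triDir k) (k + 5) ∉ K ∧ faceL (x + triDir k) (k + 4) ∉ K) ∨ ((bsucc K (x, k)).2 = k ∧ faceL (x + triDir k) (k + 1) ∈ K ∧ faceL (x + triDir k) k ∈ K ∧ faceL (x + triDir k) (k + 5) ∉ K ∧ faceL (x + triDir k) (k + 4)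 ∉ K) ∨ ((bsucc K (x, k)).2 = k + 5 ∧ faceL (x + triDir k) (k + 1) ∈ K ∧ faceL (x + triDir k) k ∈ K ∧ faceL (x + triDir k) (k + 5) ∈ K ∧ faceL (x + triDir k) (k + 4) ∉ K) ∨ ((bsucc K (x, k)).2 = k + 4 ∧ faceL (x + triDir k) (k + 1) ∈ K ∧ faceL (x + triDir k) k ∈ K ∧ faceL (x + triDir k) (k + 5) ∈ K ∧ faceL (x + triDir k) (k + 4) ∈ K)) :=
  fun _ hK _ _ hp => fan_at_head hK hp

end Summit.CriticalPhenomena.SAWScalingLimit.Theorems.PolygonParitySqueeze.BoundaryWalk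

end
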